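import Summits.MatrixMultiplication.MatrixMultiplication.Theorems.SoloInformedCwTwoAsymptoticSubrank
import Literature.Barriers.MatrixMultiplication.IrreversibilityBarrierThm9
import Literature.Barriers.MatrixMultiplication.IrreversibilityBarrierThm19
import Literature.Barriers.MatrixMultiplication.IrreversibilityBarrierProofs
import Literature.Barriers.MatrixMultiplication.IrreversibilityBarrierEx1524

/-!
# Door D1 is exactly the reversibility threshold of `T_{cw,2}`

Solo seat `solo-MatrixMultiplication-informed` (gen 3). With the seat's `Q̃(T_{cw,2}) = 3`
(`asymptoticSubrank_cwTensor_two_eq_three`) the Christandl–Vrana–Zuiddam irreversibility of the small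
Coppersmith–Winograd tensor becomes an explicit function of its asymptotic rank,

  `i(T_{cw,2}) = log₂ R̃(T_{cw,2}) / log₂ Q̃(T_{cw,2}) = log₃ R̃(T_{cw,2})`
  (`irreversibility_cwTensor_two_eq_logb`),

and the tree's PROVED irreversibility barrier (CVZ 2021, Thm. 9: `2 i(t) ≤ ω(⟨2⟩,t) · ω(t,⟨2,2,2⟩)`,
the right-hand side being the bound on `ω` that any method through the fixed intermediate tensor `t`
certifies) places the door of `SoloInformedCwTwoDoor.lean` exactly:

* `omega_le_certifiedBound_cwTensor_two` — the product `ρ_{cw₂} := ω(⟨2⟩,cw₂) · ω(cw₂,⟨2,2,2⟩)` IS a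
  bound on `ω` (CVZ Prop. 3, triangle inequality, proved in the tree; the finiteness side
  conditions are discharged here), and `certifiedBound_cwTensor_two_eq` — its first factor is
  `log₂ R̃(cw₂)`;
* `two_logb_le_certifiedBound_cwTensor_two` — **`ρ_{cw₂} ≥ 2 log₃ R̃(T_{cw,2})`**;
* `irreversibility_cwTensor_two_eq_one_iff` — **`i(cw₂) = 1 ↔ R̃(T_{cw,2}) ≤ 3`** (`↔ R̃ = Q̃`, D1), and
  `one_lt_irreversibility_cwTensor_two_iff` — `i(cw₂) > 1 ↔ R̃(T_{cw,2}) > 3`;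
* `cwTwo_threshold_dichotomy` — **either D1 holds (cw₂ reversible, and `ω = 2` by the door), or cw₂
  is irreversible and every bound certified through the fixed tensor cw₂ is `≥ 2 log₃ R̃(cw₂) > 2`.**

So D1 is not merely a sufficient condition: it is the precise threshold at which the whole
fixed-intermediate-tensor technique class (laser method and its universal/galactic/solar
refinements) on the carrier `T_{cw,2}` can reach `ω = 2`; in the kernel `1 ≤ i(cw₂) ≤ log₃ 4 = 1.26…`
(`irreversibility_cwTensor_two_mem_Icc`), in print `i(cw₂) ≤ log₃ 3.9310 = 1.246` (Alman–Li 2026,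
not formalised).

[cite: ChristandlVranaZuiddam2021, Thm. 9, Prop. 3, §2.2, Rem. 20]
[cite: CoppersmithWinograd1990, §11]
[cite: Strassen1991, §6–7]
-/

namespace Summit.MatrixMultiplication.MatrixMultiplication.Theorems

open Literature.Computability.AlgebraicComplexity
open Literature.Barriers.MatrixMultiplication

noncomputable section

/-- cw₂ satisfies CVZ's Assumption 1 (not a triad). [cite: ChristandlVranaZuiddam2021, Assumption 1] -/
theorem cwTensor_two_ne_triad' :
    ∀ w u v : Fin (2 + 1) → ℂ, cwTensor ℂ 2 ≠ triad w u v :=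
  cwTensor_ne_triad ℂ (q := 2) (by norm_num)

/-- `3 ≤ R̃(T_{cw,2})`, hence `0 < R̃(T_{cw,2})` (kernel sandwich). [cite: ChristandlVranaZuiddam2023, Example 1.4] -/
theorem asymptoticRank_cwTensor_two_pos : 0 < asymptoticRank (cwTensor ℂ 2) :=
  lt_of_lt_of_le (by norm_num) cwTensor_two_asymptotic_sandwich.2.1

/-! ## The irreversibility of `T_{cw,2}` as a function of its asymptotic rank -/

/-- **`ω(⟨2⟩, cw₂) = log₂ R̃(cw₂)`** (CVZ §2.2, proved in the tree).
[cite: ChristandlVranaZuiddam2021, §2.2] -/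
theorem relativeExponent_unit_cwTensor_two_eq :
    relativeExponent (unitTensor ℂ 2) (cwTensor ℂ 2) = Real.logb 2 (asymptoticRank (cwTensor ℂ 2)) :=
  (CVZ2021_relativeExponent_unit_holds ℂ (cwTensor ℂ 2) cwTensor_two_ne_triad').1

/-- **`ω(cw₂, ⟨2⟩) = 1 / log₂ 3`** (CVZ §2.2 with the seat's `Q̃(cw₂) = 3`).
[cite: ChristandlVranaZuiddam2021, §2.2] [cite: Strassen1991, §6–7] -/
theorem relativeExponent_cwTensor_two_unit_eq :
    relativeExponent (cwTensor ℂ 2) (unitTensor ℂ 2) = 1 / Real.logb 2 3 := by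
  rw [(CVZ2021_relativeExponent_unit_holds ℂ (cwTensor ℂ 2) cwTensor_two_ne_triad').2,
    asymptoticSubrank_cwTensor_two_eq_three]

/-- **`i(T_{cw,2}) = log₃ R̃(T_{cw,2})`.** [cite: ChristandlVranaZuiddam2021, Def. 4 and §2.2] -/
theorem irreversibility_cwTensor_two_eq_logb :
    irreversibility (cwTensor ℂ 2) = Real.logb 3 (asymptoticRank (cwTensor ℂ 2)) := by
  have h2 : Real.log 2 ≠ 0 := (Real.log_pos one_lt_two).ne'
  have h3 : Real.log 3 ≠ 0 := (Real.log_pos (by norm_num : (1 : ℝ) < 3)).ne'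
  rw [irreversibility, relativeExponent_unit_cwTensor_two_eq, relativeExponent_cwTensor_two_unit_eq]
  simp only [Real.logb]
  field_simp

/-- Kernel range: **`1 ≤ i(cw₂) ≤ log₃ 4`** (from `3 ≤ R̃(cw₂) ≤ 4`).
[cite: ChristandlVranaZuiddam2021, Prop. 5 and Rem. 20] -/
theorem irreversibility_cwTensor_two_mem_Icc :
    irreversibility (cwTensor ℂ 2) ∈ Set.Icc (1 : ℝ) (Real.logb 3 4) := by
  rw [irreversibility_cwTensor_two_eq_logb]
  have h3 : (3 : ℝ) ≤ asymptoticRank (cwTensor ℂ 2) := cwTensor_two_asymptotic_sandwich.2.1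
  have h4 : asymptoticRank (cwTensor ℂ 2) ≤ 4 := cwTensor_two_asymptotic_sandwich.2.2
  have hb : (1 : ℝ) < 3 := by norm_num
  constructor
  · rw [← Real.logb_self_eq_one hb]
    exact Real.logb_le_logb_of_le hb (by norm_num) h3
  · exact Real.logb_le_logb_of_le hb asymptoticRank_cwTensor_two_pos h4

/-- **`i(cw₂) = 1 ↔ R̃(T_{cw,2}) ≤ 3`**: cw₂ is reversible exactly when door D1 holds.
[cite: ChristandlVranaZuiddam2021, Def. 6 and Rem. 20] -/
theorem irreversibility_cwTensor_two_eq_one_iff :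
    irreversibility (cwTensor ℂ 2) = 1 ↔ asymptoticRank (cwTensor ℂ 2) ≤ 3 := by
  rw [irreversibility_cwTensor_two_eq_logb]
  have h3 : (3 : ℝ) ≤ asymptoticRank (cwTensor ℂ 2) := cwTensor_two_asymptotic_sandwich.2.1
  rw [Real.logb_eq_iff_rpow_eq (by norm_num) (by norm_num) asymptoticRank_cwTensor_two_pos,
    Real.rpow_one]
  constructor
  · intro h; rw [← h]
  · intro h; linarith

/-- **`i(cw₂) > 1 ↔ R̃(T_{cw,2}) > 3`**: cw₂ is irreversible exactly when D1 fails.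
[cite: ChristandlVranaZuiddam2021, Def. 6] -/
theorem one_lt_irreversibility_cwTensor_two_iff :
    1 < irreversibility (cwTensor ℂ 2) ↔ 3 < asymptoticRank (cwTensor ℂ 2) := by
  rw [irreversibility_cwTensor_two_eq_logb,
    Real.lt_logb_iff_rpow_lt (by norm_num : (1 : ℝ) < 3) asymptoticRank_cwTensor_two_pos,
    Real.rpow_one]

/-- D1 as reversibility: `R̃(T_{cw,2}) = Q̃(T_{cw,2}) ↔ i(cw₂) = 1`.
[cite: ChristandlVranaZuiddam2021, Def. 6] -/
theorem asymptoticRank_eq_asymptoticSubrank_cwTensor_two_iff_reversible :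
    asymptoticRank (cwTensor ℂ 2) = asymptoticSubrank ℂ (cwTensor ℂ 2) ↔
      irreversibility (cwTensor ℂ 2) = 1 := by
  rw [irreversibility_cwTensor_two_eq_one_iff,
    asymptoticRank_cwTensor_two_le_three_iff_eq_asymptoticSubrank]

/-! ## The bound certified through `cw₂` and the barrier -/

/-- Some power of cw₂ restricts to `⟨2,2,2⟩` (`cw₂^{⊗2k} ≥ ⟨2⟩^{⊗3} ≅ ⟨8⟩ ≥ ⟨2,2,2⟩`); hence every
set defining `ω(cw₂, ⟨2,2,2⟩)` is nonempty. [folklore] -/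
theorem exists_cwTwoPow_restrictsTo_matMulPow (n : ℕ) :
    ∃ m, TensorRestrictsTo (kroneckerPow (cwTensor ℂ 2) m)
      (kroneckerPow (matMulTensor ℂ 2 2 2) (n + 1)) := by
  obtain ⟨m₀, hm₀⟩ := exists_cwPow_restrictsTo_unitPow (K := ℂ) (q := 2) (by norm_num) 3
  have h8 : TensorRestrictsTo (unitTensor ℂ ((2 ^ 3) ^ 1)) (matMulTensor ℂ 2 2 2) :=
    tensorRestrictsTo_unitTensor_of_tensorRank_le _
      ((tensorRank_matMulTensor_le ℂ 2 2 2).trans (by norm_num))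
  have hw : TensorRestrictsTo (kroneckerPow (cwTensor ℂ 2) (1 * m₀)) (matMulTensor ℂ 2 2 2) :=
    (restrictsTo_unitTensor_pow_of_cwPow_restrictsTo_unitPow hm₀ 1).trans h8
  exact exists_tensorRestrictsTo_pow_of_witness hw n

/-- **The method through cw₂ is sound: `ω ≤ ω(⟨2⟩,cw₂) · ω(cw₂,⟨2,2,2⟩)`** (CVZ (3.1): triangle
inequality, Prop. 3, and `ω(⟨2⟩,⟨2,2,2⟩) = ω`, both proved in the tree).
[cite: ChristandlVranaZuiddam2021, Prop. 3 and §3.1] -/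
theorem omega_le_certifiedBound_cwTensor_two :
    omega ℂ ≤ relativeExponent (unitTensor ℂ 2) (cwTensor ℂ 2) *
      relativeExponent (cwTensor ℂ 2) (matMulTensor ℂ 2 2 2) := by
  rw [← relativeExponent_unit_matMul_eq_omega' ℂ]
  exact relativeExponent_triangle (fun p => exists_unitPow_restrictsTo_cwPow (K := ℂ) 2 (p + 1))
    exists_cwTwoPow_restrictsTo_matMulPow

/-- The certified bound factors as `log₂ R̃(cw₂) · ω(cw₂, ⟨2,2,2⟩)`.
[cite: ChristandlVranaZuiddam2021, §2.2 and §3.1] -/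
theorem certifiedBound_cwTensor_two_eq :
    relativeExponent (unitTensor ℂ 2) (cwTensor ℂ 2) *
        relativeExponent (cwTensor ℂ 2) (matMulTensor ℂ 2 2 2) =
      Real.logb 2 (asymptoticRank (cwTensor ℂ 2)) *
        relativeExponent (cwTensor ℂ 2) (matMulTensor ℂ 2 2 2) := by
  rw [relativeExponent_unit_cwTensor_two_eq]

/-- **`ω(cw₂, ⟨2,2,2⟩) ≥ 2 / log₂ 3`** (the rate inequality `2 ω(t,⟨2⟩) ≤ ω(t,⟨2,2,2⟩)` behind
Thm. 9, with `ω(cw₂,⟨2⟩) = 1/log₂ 3`). [cite: ChristandlVranaZuiddam2021, Thm. 9 (proof)] -/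
theorem two_div_logb_le_relativeExponent_cwTensor_two_matMul :
    2 / Real.logb 2 3 ≤ relativeExponent (cwTensor ℂ 2) (matMulTensor ℂ 2 2 2) := by
  have h := two_mul_relativeExponent_unit_le (cwTensor ℂ 2)
  rw [relativeExponent_cwTensor_two_unit_eq] at h
  have h2 : 2 / Real.logb 2 3 = 2 * (1 / Real.logb 2 3) := by ring
  rw [h2]
  exact h

/-- **The barrier floor through cw₂: `ω(⟨2⟩,cw₂) · ω(cw₂,⟨2,2,2⟩) ≥ 2 log₃ R̃(T_{cw,2})`**
(CVZ Thm. 9, proved in the tree, at `t = cw₂`, with `i(cw₂) = log₃ R̃(cw₂)`).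
[cite: ChristandlVranaZuiddam2021, Thm. 9] -/
theorem two_logb_le_certifiedBound_cwTensor_two :
    2 * Real.logb 3 (asymptoticRank (cwTensor ℂ 2)) ≤
      relativeExponent (unitTensor ℂ 2) (cwTensor ℂ 2) *
        relativeExponent (cwTensor ℂ 2) (matMulTensor ℂ 2 2 2) := by
  rw [← irreversibility_cwTensor_two_eq_logb]
  exact CVZ2021_thm9_holds ℂ (cwTensor ℂ 2) cwTensor_two_ne_triad'

/-- If D1 fails, every bound certified through the fixed tensor cw₂ exceeds `2`.
[cite: ChristandlVranaZuiddam2021, §3.1] -/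
theorem two_lt_certifiedBound_cwTensor_two_of_three_lt
    (h : 3 < asymptoticRank (cwTensor ℂ 2)) :
    2 < relativeExponent (unitTensor ℂ 2) (cwTensor ℂ 2) *
      relativeExponent (cwTensor ℂ 2) (matMulTensor ℂ 2 2 2) :=
  two_lt_of_one_lt_irreversibility (cwTensor ℂ 2) cwTensor_two_ne_triad'
    (one_lt_irreversibility_cwTensor_two_iff.2 h)

/-! ## The threshold dichotomy -/

/-- **D1 is exactly the reversibility threshold of `T_{cw,2}`.** Either `R̃(T_{cw,2}) ≤ 3` — cw₂ is
reversible and `ω = 2` (door D1) — or `R̃(T_{cw,2}) > 3` — cw₂ is irreversible and every bound on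
`ω` certified through the fixed intermediate tensor cw₂ is at least `2 log₃ R̃(T_{cw,2}) > 2`.
[cite: ChristandlVranaZuiddam2021, Thm. 9 and Rem. 20] [cite: CoppersmithWinograd1990, §11] -/
theorem cwTwo_threshold_dichotomy :
    (asymptoticRank (cwTensor ℂ 2) ≤ 3 ∧ irreversibility (cwTensor ℂ 2) = 1 ∧
        _root_.MatrixMultiplication) ∨
      (3 < asymptoticRank (cwTensor ℂ 2) ∧ 1 < irreversibility (cwTensor ℂ 2) ∧
        2 < 2 * Real.logb 3 (asymptoticRank (cwTensor ℂ 2)) ∧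
        2 * Real.logb 3 (asymptoticRank (cwTensor ℂ 2)) ≤
          relativeExponent (unitTensor ℂ 2) (cwTensor ℂ 2) *
            relativeExponent (cwTensor ℂ 2) (matMulTensor ℂ 2 2 2)) := by
  rcases le_or_gt (asymptoticRank (cwTensor ℂ 2)) 3 with h | h
  · exact Or.inl ⟨h, irreversibility_cwTensor_two_eq_one_iff.2 h,
      matrixMultiplication_of_asymptoticRank_cwTensor_two_le_three h⟩
  · refine Or.inr ⟨h, one_lt_irreversibility_cwTensor_two_iff.2 h, ?_,
      two_logb_le_certifiedBound_cwTensor_two⟩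
    have h1 : 1 < Real.logb 3 (asymptoticRank (cwTensor ℂ 2)) := by
      rw [← irreversibility_cwTensor_two_eq_logb]
      exact one_lt_irreversibility_cwTensor_two_iff.2 h
    linarith

/-- Quantitative form: if `R̃(T_{cw,2}) ≥ 3 (1 + δ)` then no method through the fixed tensor cw₂
certifies a bound below `2 + 2 log₃ (1 + δ)`. [cite: ChristandlVranaZuiddam2021, Thm. 9] -/
theorem certifiedBound_cwTensor_two_ge_of_le {δ : ℝ} (hδ : 0 ≤ δ)
    (h : 3 * (1 + δ) ≤ asymptoticRank (cwTensor ℂ 2)) :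
    2 + 2 * Real.logb 3 (1 + δ) ≤
      relativeExponent (unitTensor ℂ 2) (cwTensor ℂ 2) *
        relativeExponent (cwTensor ℂ 2) (matMulTensor ℂ 2 2 2) := by
  refine le_trans ?_ two_logb_le_certifiedBound_cwTensor_two
  have hb : (1 : ℝ) < 3 := by norm_num
  have hpos : 0 < 3 * (1 + δ) := by positivity
  have hmono : Real.logb 3 (3 * (1 + δ)) ≤ Real.logb 3 (asymptoticRank (cwTensor ℂ 2)) :=
    Real.logb_le_logb_of_le hb hpos h
  have hsplit : Real.logb 3 (3 * (1 + δ)) = 1 + Real.logb 3 (1 + δ) := by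
    rw [Real.logb_mul (by norm_num) (by positivity), Real.logb_self_eq_one hb]
  linarith

end

end Summit.MatrixMultiplication.MatrixMultiplication.Theorems
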